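import Literature.MathematicalPhysics.QuantumLattice.InfVolFermionStateCompactness
import Literature.MathematicalPhysics.QuantumLattice.InfVolFermionStateDensity
import Literature.MathematicalPhysics.QuantumLattice.InfVolFermionStateHubbardEnergy
import Literature.MathematicalPhysics.QuantumLattice.HubbardChainEnergyDensityAt
import Literature.MathematicalPhysics.QuantumLattice.SectorEigenvalueContinuation
import HarnessLib

/-!
# Ring ground states of the Hubbard chain have translation-invariant thermodynamic-limit states
# carrying the chain energy density `hubbardChainEnergyDensityAt` at every rational filling

Family `hubbard` (topic `MathematicalPhysics/QuantumLattice`). The one-dimensional twin of the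
ATTAINED half of the tree's 2D variational principle
(`InfVolFermionState.exists_isTranslationInvariant_hubbardEnergyDensity_eq`,
HubbardEnergyDensityVariationalPrinciple): for `U ≥ 0` and a rational filling `p/q`
(`1 ≤ q`, `p ≤ 2q`), the rings `ℤ/(2qj)ℤ` with `2pj` electrons carry unit sector ground states
(`(N, S^z) = (2pj, 0)`; Lieb 1989: every spin multiplet meets `S^z = 0`, so the sector energy is the
`N`-electron ground energy `groundEnergyAt`), and ANY thermodynamic limit `ω` of them along a
subsequence (compactness of the state space, Bratteli–Robinson I Thm 2.3.15;
`InfVolFermionState.exists_isTorusLimitOf_subseq_of_isNParticle`) is a translation-invariant, even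
infinite-volume state of the lattice fermion system on `ℤ` with particle density `p/q` whose Hubbard
energy density equals Ruelle's thermodynamic limit `hubbardChainEnergyDensityAt t U p q` of the ring
ground-state energies per site (Ruelle 1969 §2.2/§3; Bratteli–Robinson II §6.2.4: the mean energy of a
periodic-box limit state is the limit of `E₀/|Λ|`). PROVED here
(`exists_isTorusLimitOf_ringGroundStates_hubbardEnergyDensity_eq`): the limit state comes WITH the
ring ground states it is a limit of — the hypothesis class on which bootstrap rows that are valid for
translation-invariant infinite-chain states (and commutator rows valid for limits of ring eigenstates)
are evaluated — and the corollary `le_hubbardChainEnergyDensityAt_of_forall_torusLimit`: a lower bound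
valid for every such state is a lower bound on `hubbardChainEnergyDensityAt` (resp.
`hubbardChainEnergyDensity` at half filling). No definition, no named fact. The converse inequality
(Ruelle's variational principle: `e₀ ≤ e(ω)` for EVERY translation-invariant `ω` of density `p/q`) is the
2D tree theorem `IsTranslationInvariant.energyDensity2D_le_hubbardEnergyDensity` and is NOT ported here.

## References
* D. Ruelle, *Statistical Mechanics: Rigorous Results* (Benjamin 1969), §2.2 (thermodynamic limit of
  the ground-state energy per site by subadditivity), §3.3–3.4 (periodic boxes; states of given
  density). [cite: Ruelle1969, §3.4]
* O. Bratteli, A. Kishimoto, D. W. Robinson, *Ground states of quantum spin systems*, Commun. Math.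
  Phys. 64 (1978) 41–48, §3 (mean energy functional of a translation-invariant state; Theorem 2).
  [cite: BratteliKishimotoRobinson1978, §3]
* O. Bratteli, D. W. Robinson, *Operator Algebras and Quantum Statistical Mechanics I*, 2nd ed.
  (Springer 1987), Thm 2.3.15 (weak-* compactness of the state space), §4.3.1 (invariant states).
  [cite: BratteliRobinsonI1987, Thm. 2.3.15]
* E. H. Lieb, *Two theorems on the Hubbard model*, Phys. Rev. Lett. 62 (1989) 1201, proof of Thm 1
  (one may take `S^z = 0`). [cite: LiebPRL1989, proof of Theorem 1]
-/

noncomputable section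

namespace Literature.MathematicalPhysics.QuantumLattice

open Matrix Finset HubbardWave0 _root_.Filter Literature.Probability.LatticeModels ThermodynamicLimit
open scoped _root_.Topology ComplexOrder

variable (t U : ℝ)

/-! ### Unit sector ground states on rings and their energies -/

/-- **Unit sector ground states exist on every ring**: for `n ≤ L` the Hubbard ring
`hubbardTorus 1 L t U` has a unit ground state in the joint sector `(N, S^z) = (2n, 0)`.
[cite: LiebPRL1989, eqs. (1)–(2)] -/
theorem exists_unit_isGroundStateInSector_ring (L n : ℕ) (hn : n ≤ L) :
    ∃ ψ : Fock (Orb (FermionTorus 1 L)), star ψ ⬝ᵥ ψ = 1 ∧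
      IsGroundStateInSector (hubbardTorus 1 L t U) (2 * n) 0 ψ := by
  have hm : n ≤ Fintype.card (FermionTorus 1 L) := by simpa using hn
  obtain ⟨⟨ψ, hψS, hψ0, hH⟩, -⟩ := szSector_groundState (fermionTorusGraph 1 L) t U hm
  obtain ⟨c, hc, -, hc1⟩ := EigenvalueContinuation.exists_normalize hψ0
  refine ⟨(c : ℂ) • ψ, hc1, Submodule.smul_mem _ _ hψS, smul_ne_zero (by exact_mod_cast hc.ne') hψ0, ?_⟩
  rw [hubbardTorus, Matrix.mulVec_smul]
  exact (congrArg ((c : ℂ) • ·) hH).trans (smul_comm _ _ _)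

/-- The energy of a unit sector ground state of the ring `ℤ/Lℤ` in the sector `(2n, S^z = 0)`,
`n ≤ L`, is the `2n`-electron ground energy `E_L(2n)` (`groundEnergyAt_eq_minEnergyOn_szSector`:
every spin multiplet meets `S^z = 0`). [cite: LiebPRL1989, proof of Theorem 1] -/
theorem re_rayleigh_hubbardTorus_of_isGroundStateInSector_ring (L n : ℕ) (hn : n ≤ L)
    {ψ : Fock (Orb (FermionTorus 1 L))} (hψ : IsGroundStateInSector (hubbardTorus 1 L t U) (2 * n) 0 ψ)
    (h1 : star ψ ⬝ᵥ ψ = 1) :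
    (star ψ ⬝ᵥ (hubbardTorus 1 L t U *ᵥ ψ)).re = groundEnergyAt (fermionTorusGraph 1 L) t U (2 * n) := by
  obtain ⟨-, -, hH⟩ := hψ
  have hcard : n ≤ Fintype.card (FermionTorus 1 L) := by simpa using hn
  rw [hH, dotProduct_smul, h1, smul_eq_mul, mul_one, Complex.ofReal_re,
    groundEnergyAt_eq_minEnergyOn_szSector _ t U hcard]
  rfl

/-- A sector ground state in `(2n, S^z = 0)` of the ring is an `N`-electron ground state
(`IsGroundState`, `N = 2n`) of the ring Hamiltonian. [cite: LiebPRL1989, proof of Theorem 1] -/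
theorem isGroundState_of_isGroundStateInSector_ring (L n : ℕ) (hn : n ≤ L)
    {ψ : Fock (Orb (FermionTorus 1 L))} (hψ : IsGroundStateInSector (hubbardTorus 1 L t U) (2 * n) 0 ψ) :
    IsGroundState (hamiltonian (fermionTorusGraph 1 L) t U) (2 * n) ψ := by
  obtain ⟨hS, h0, hH⟩ := hψ
  have hcard : n ≤ Fintype.card (FermionTorus 1 L) := by simpa using hn
  refine ⟨((mem_szSector_iff _ _ _).1 hS).1, h0, ?_⟩
  rw [hubbardTorus] at hH
  rw [hH, ← groundEnergyAt_eq_minEnergyOn_szSector _ t U hcard]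
  rfl

/-! ### The thermodynamic-limit state of ring ground states at filling `p/q` -/

/-- **Ring ground states have translation-invariant thermodynamic-limit states carrying the chain
energy density.** For `U ≥ 0`, `1 ≤ q`, `p ≤ 2q` there are: a family `ψ` of unit vectors on the rings
`ℤ/Lℤ`, ring sizes `L_j → ∞` (in fact `L_j = 2q·φ j` along a subsequence `φ`) on which the `ψ (L_j)` are
sector ground states with `2p·φ j` electrons and `S^z = 0` (hence `N`-electron ground states,
`IsGroundState`), and an infinite-volume state `ω` on `ℤ` that is their torus limit — translation
invariant and even, of particle density `p/q`, with
`ω.hubbardEnergyDensity t U = hubbardChainEnergyDensityAt t U p q`.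
[cite: Ruelle1969, §3.4; BratteliKishimotoRobinson1978, §3] -/
theorem exists_isTorusLimitOf_ringGroundStates_hubbardEnergyDensity_eq {U : ℝ} (hU : 0 ≤ U)
    {p q : ℕ} (hq : 1 ≤ q) (hp : p ≤ 2 * q) :
    ∃ (ψ : ∀ L, Fock (Orb (FermionTorus 1 L))) (Ls : ℕ → ℕ) (ω : InfVolFermionState 1),
      Tendsto Ls atTop atTop ∧ ω.IsTorusLimitOf ψ Ls ∧ ω.IsTranslationInvariant ∧ ω.IsEven ∧
      (∀ j, star (ψ (Ls j)) ⬝ᵥ ψ (Ls j) = 1) ∧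
      (∀ j, ∃ n, n ≤ Ls j ∧ IsGroundStateInSector (hubbardTorus 1 (Ls j) t U) (2 * n) 0 (ψ (Ls j)) ∧
        IsGroundState (hamiltonian (fermionTorusGraph 1 (Ls j)) t U) (2 * n) (ψ (Ls j))) ∧
      ω.density = (p : ℝ) / q ∧
      ω.hubbardEnergyDensity t U = hubbardChainEnergyDensityAt t U p q := by
  -- electron number on the ring of length `L`: `2 · n L`, `n L = p ⌊L / 2q⌋` (so `n (q(2j)) = p j`)
  set n : ℕ → ℕ := fun L => p * (L / (2 * q)) with hn
  have hq0 : 0 < 2 * q := by omega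
  have hnL : ∀ L, n L ≤ L := by
    intro L
    have h1 : p * (L / (2 * q)) ≤ 2 * q * (L / (2 * q)) := Nat.mul_le_mul_right _ hp
    exact h1.trans (Nat.mul_div_le L (2 * q))
  choose ψ hψ1 hψ using fun L => exists_unit_isGroundStateInSector_ring t U L (n L) (hnL L)
  have hN : ∀ L, IsNParticle (2 * n L) (ψ L) := fun L => ((mem_szSector_iff _ _ _).1 (hψ L).1).1
  -- the rings `L = q · (2j)`
  have hLs : Tendsto (fun j : ℕ => q * (2 * j)) atTop atTop := by
    refine tendsto_atTop_mono (fun j => ?_) tendsto_id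
    exact (show j ≤ 2 * j by omega).trans (Nat.le_mul_of_pos_left (2 * j) (by omega))
  obtain ⟨φ, hφ, ω, hω, hti, hev⟩ :=
    InfVolFermionState.exists_isTorusLimitOf_subseq_of_isNParticle ψ hN hLs fun j => hψ1 _
  have hφ' : Tendsto ((fun j : ℕ => q * (2 * j)) ∘ φ) atTop atTop := hLs.comp hφ.tendsto_atTop
  have hnj : ∀ j, n (q * (2 * φ j)) = p * φ j := by
    intro j
    simp only [hn]
    rw [show q * (2 * φ j) = 2 * q * φ j by ring, Nat.mul_div_cancel_left _ hq0]
  -- the energy per site of `ψ (q(2 φ j))` is the ring energy `E_{q m}(p m)/(q m)` at `m = 2 φ j`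
  have key : ∀ j, groundEnergyAt (fermionTorusGraph 1 (q * (2 * φ j))) t U (p * (2 * φ j)) /
      ((q * (2 * φ j) : ℕ) : ℝ) =
      (star (ψ (q * (2 * φ j))) ⬝ᵥ (hubbardTorus 1 (q * (2 * φ j)) t U *ᵥ ψ (q * (2 * φ j)))).re /
        ((q * (2 * φ j) : ℕ) : ℝ) ^ 1 := by
    intro j
    rw [pow_one, re_rayleigh_hubbardTorus_of_isGroundStateInSector_ring t U _ _ (hnL _) (hψ _) (hψ1 _),
      hnj, show p * (2 * φ j) = 2 * (p * φ j) by ring]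
  refine ⟨ψ, (fun j : ℕ => q * (2 * j)) ∘ φ, ω, hφ', hω, hti, hev, fun j => hψ1 _, fun j => ?_, ?_, ?_⟩
  · refine ⟨n (q * (2 * φ j)), hnL _, hψ _, ?_⟩
    exact isGroundState_of_isGroundStateInSector_ring t U _ _ (hnL _) (hψ _)
  · -- density: `N_j / L_j = 2p φ j / (2q φ j) = p/q` for `φ j ≥ 1`
    refine hω.density_eq hφ' (fun j => hN _) (fun j => hψ1 _) ?_
    refine tendsto_const_nhds.congr' ?_
    filter_upwards [(hφ.tendsto_atTop).eventually_ge_atTop 1] with j hj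
    simp only [Function.comp_apply, hnj, pow_one]
    have hφj : (0 : ℝ) < φ j := by exact_mod_cast hj
    have hq' : (0 : ℝ) < q := by exact_mod_cast hq
    push_cast
    field_simp
  · -- energy density: the ring energies per site along `m = 2 φ j` converge to `e(t,U;p/q)`
    refine hω.hubbardEnergyDensity_eq t U hφ' ?_
    have h2 : Tendsto (fun j : ℕ => 2 * φ j) atTop atTop :=
      (tendsto_atTop_mono (fun j => show j ≤ 2 * j by omega) tendsto_id).comp hφ.tendsto_atTop
    have hlim := (tendsto_hubbardChainEnergyDensityAt t hU hq hp).comp h2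
    refine hlim.congr' (Eventually.of_forall fun j => ?_)
    exact key j

/-- **The chain energy density is attained by a translation-invariant even state of the right
density** (d = 1 twin of `InfVolFermionState.exists_isTranslationInvariant_hubbardEnergyDensity_eq`).
[cite: Ruelle1969, §3.4] -/
theorem exists_isTranslationInvariant_hubbardEnergyDensity_eq_chainAt {U : ℝ} (hU : 0 ≤ U)
    {p q : ℕ} (hq : 1 ≤ q) (hp : p ≤ 2 * q) :
    ∃ ω : InfVolFermionState 1, ω.IsTranslationInvariant ∧ ω.IsEven ∧ ω.density = (p : ℝ) / q ∧
      ω.hubbardEnergyDensity t U = hubbardChainEnergyDensityAt t U p q := by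
  obtain ⟨-, -, ω, -, -, hti, hev, -, -, hdens, he⟩ :=
    exists_isTorusLimitOf_ringGroundStates_hubbardEnergyDensity_eq t hU hq hp
  exact ⟨ω, hti, hev, hdens, he⟩

/-- Membership form: the chain energy density at filling `p/q` belongs to the set of Hubbard energy
densities of translation-invariant states of density `p/q` (the attained half of the variational
principle; the `IsLeast` half is Ruelle's variational inequality, in the tree for `d = 2` only).
[cite: BratteliKishimotoRobinson1978, §3] -/
theorem hubbardChainEnergyDensityAt_mem_energies_of_isTranslationInvariant {U : ℝ} (hU : 0 ≤ U)
    {p q : ℕ} (hq : 1 ≤ q) (hp : p ≤ 2 * q) :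
    hubbardChainEnergyDensityAt t U p q ∈ {e : ℝ | ∃ ω : InfVolFermionState 1, ω.IsTranslationInvariant ∧
      ω.density = (p : ℝ) / q ∧ ω.hubbardEnergyDensity t U = e} := by
  obtain ⟨ω, hti, -, hdens, he⟩ := exists_isTranslationInvariant_hubbardEnergyDensity_eq_chainAt t hU hq hp
  exact ⟨ω, hti, hdens, he⟩

/-- **Corollary (transport of lower bounds valid for translation-invariant limit states).** If a real
number `E` is a lower bound on the Hubbard energy density of every translation-invariant, even
infinite-volume state of density `p/q` that is a torus limit of unit `S^z = 0` sector ground states of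
the rings — the hypothesis class of a bootstrap certificate whose rows hold for translation-invariant
states of the infinite chain (positivity, local translation invariance, further state inequalities) and
for limits of ring eigenstates (commutator rows) — then `E ≤ hubbardChainEnergyDensityAt t U p q`.
[cite: Ruelle1969, §3.4] -/
theorem le_hubbardChainEnergyDensityAt_of_forall_torusLimit {U : ℝ} (hU : 0 ≤ U) {p q : ℕ} (hq : 1 ≤ q)
    (hp : p ≤ 2 * q) {E : ℝ}
    (hE : ∀ (ω : InfVolFermionState 1) (ψ : ∀ L, Fock (Orb (FermionTorus 1 L))) (Ls : ℕ → ℕ),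
      Tendsto Ls atTop atTop → ω.IsTorusLimitOf ψ Ls → ω.IsTranslationInvariant → ω.IsEven →
      (∀ j, star (ψ (Ls j)) ⬝ᵥ ψ (Ls j) = 1) →
      (∀ j, ∃ n, IsGroundStateInSector (hubbardTorus 1 (Ls j) t U) (2 * n) 0 (ψ (Ls j))) →
      ω.density = (p : ℝ) / q → E ≤ ω.hubbardEnergyDensity t U) :
    E ≤ hubbardChainEnergyDensityAt t U p q := by
  obtain ⟨ψ, Ls, ω, hLs, hω, hti, hev, h1, hgs, hdens, he⟩ :=
    exists_isTorusLimitOf_ringGroundStates_hubbardEnergyDensity_eq t hU hq hp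
  rw [← he]
  exact hE ω ψ Ls hLs hω hti hev h1 (fun j => (hgs j).imp fun n hn => hn.2.1) hdens

/-- Half filling (`p = q = 1`): the same transport to `hubbardChainEnergyDensity t U`.
[cite: Ruelle1969, §3.4] -/
theorem le_hubbardChainEnergyDensity_of_forall_torusLimit {U : ℝ} (hU : 0 ≤ U) {E : ℝ}
    (hE : ∀ (ω : InfVolFermionState 1) (ψ : ∀ L, Fock (Orb (FermionTorus 1 L))) (Ls : ℕ → ℕ),
      Tendsto Ls atTop atTop → ω.IsTorusLimitOf ψ Ls → ω.IsTranslationInvariant → ω.IsEven →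
      (∀ j, star (ψ (Ls j)) ⬝ᵥ ψ (Ls j) = 1) →
      (∀ j, ∃ n, IsGroundStateInSector (hubbardTorus 1 (Ls j) t U) (2 * n) 0 (ψ (Ls j))) →
      ω.density = 1 → E ≤ ω.hubbardEnergyDensity t U) :
    E ≤ hubbardChainEnergyDensity t U := by
  rw [← hubbardChainEnergyDensityAt_one_one t hU]
  refine le_hubbardChainEnergyDensityAt_of_forall_torusLimit t hU le_rfl (by norm_num) ?_
  intro ω ψ Ls hLs hω hti hev h1 hgs hdens
  exact hE ω ψ Ls hLs hω hti hev h1 hgs (by simpa using hdens)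

end Literature.MathematicalPhysics.QuantumLattice
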